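/-
Solo seat `solo-MatrixMultiplication-informed` (gen 17): the catalyst door (D10) is closed at every
finite level for EVERY `1_A`-generic square catalyst, not only unit tensors.
-/
import Summits.MatrixMultiplication.MatrixMultiplication.Theorems.SoloInformedCatalystNoGo
import Literature.Computability.AlgebraicComplexity.MatrixMultiplicationExponent

/-!
# No `1_A`-generic catalyst certifies `R̃(T_cw,2) = 3` at a finite level

`SoloInformedCatalystDoor.lean` (door D10) showed `R̃(t)^N + Q̃(s) ≤ R̲(t^{⊠N} ⊕ s)`, so a
border-rank identity `R̲(T_cw,2^{⊠N} ⊕ s) ≤ 3^N + Q̃(s)` for one `N ≥ 1` would give `R̃(T_cw,2) = 3`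
and hence `ω = 2`; `SoloInformedCatalystNoGo.lean` refuted this for unit catalysts `s = ⟨m⟩`.
Here the same twisted Strassen equations refute it for every catalyst `s ∈ K^{ι'} ⊗ K^{κ'} ⊗ K^{κ'}`
having an invertible slice `s(σ)` in the first factor (`1_A`-generic catalysts):
`3^N + |κ'| < R̲(T_cw,2^{⊠N} ⊕ s)` — and `Q̃(s) ≤ |κ'|` always.  Instances: the power itself
(`2·3^N < R̲(T_cw,2^{⊠N} ⊕ T_cw,2^{⊠N})`) and matrix multiplication tensors
(`3^N + n² < R̲(T_cw,2^{⊠N} ⊕ ⟨n,n,n⟩)`, the Coppersmith–Winograd 1982 type of catalyst).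
What survives (paper §2j): catalysts that are not `1_A`-generic in any factor ordering reaching the
bound, and the limit `N → ∞` (the door's summit form needs `R̲(T_cw,2^{⊠N} ⊕ s_N) = 3^N + Q̃(s_N) +
o(3^N)`-type families, which these equations do not exclude).

References: [cite: Landsberg2017, Prop. 2.2.1.3, Thm. 2.2.2.1 (Strassen's equations)];
[cite: Blaser2013, §5 (the tensor ⟨k,m,n⟩)]; arXiv:1902.06582, Problem 2 (additivity of border rank
under `⊕`, open).
-/

noncomputable section

open scoped BigOperators Polynomial Matrix
open Matrix Polynomial

namespace Summit.MatrixMultiplication.MatrixMultiplication.Theorems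

open Literature.Computability.AlgebraicComplexity

universe u

section Generic

open CatalystNoGo

variable (K : Type u) [Field K]

/-- **`3^N + d < R̲(T_cw,2^{⊠N} ⊕ s)` for every catalyst `s ∈ K^{ι'} ⊗ K^{κ'} ⊗ K^{κ'}`, `d = |κ'|`,
with an invertible first-factor slice `s(σ)`** (`N ≥ 1`; e.g. `s = ⟨n,n,n⟩`, `s` a unit tensor, `s`
a Kronecker power of `T_cw,q`): the twist `(S⁻¹)^{⊗N} ⊕ s(σ)⁻¹` makes the slice at `(a₀^*+a₁^*)^{⊗N}
⊕ σ` the identity and Strassen's equations fail on the `T_cw,2`-blocks exactly as in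
`lt_algBorderRank_kroneckerPow_cwTensor_two_directSum_unit`.  Since `R̃(T_cw,2)^N + Q̃(s) ≤
R̲(T_cw,2^{⊠N} ⊕ s)` and `Q̃(s) ≤ d`, no such catalyst certifies `R̃(T_cw,2) = 3` at a finite level.
[cite: Landsberg2017, Prop. 2.2.1.3, Thm. 2.2.2.1] -/
theorem lt_algBorderRank_kroneckerPow_cwTensor_two_directSum_of_isUnit_slice {ι' κ' : Type*}
    [Fintype ι'] [DecidableEq ι'] [Fintype κ'] [DecidableEq κ'] (s : ι' → κ' → κ' → K) (σ : ι' → K)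
    (hσ : IsUnit (contractFirst σ s)) (N : ℕ) :
    3 ^ (N + 1) + Fintype.card κ' <
      algBorderRank (directSumTensor (kroneckerPow (cwTensor K 2) (N + 1)) s) := by
  classical
  by_contra hle
  rw [not_lt] at hle
  set T := directSumTensor (kroneckerPow (cwTensor K 2) (N + 1)) s with hT
  set M : ℕ := Fintype.card ((Fin (N + 1) → Fin 3) ⊕ κ') with hMdef
  have hM : M = 3 ^ (N + 1) + Fintype.card κ' := by simp [hMdef, Fintype.card_sum]
  set e : Fin M ≃ ((Fin (N + 1) → Fin 3) ⊕ κ') := (Fintype.equivFin _).symm with he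
  -- the twist `G = (S⁻¹)^{⊗(N+1)} ⊕ s(σ)⁻¹` on the second factor
  set G : Matrix ((Fin (N + 1) → Fin 3) ⊕ κ') ((Fin (N + 1) → Fin 3) ⊕ κ') K :=
    Matrix.fromBlocks (powMatrix (cwSinv K) (N + 1)) 0 0 (contractFirst σ s)⁻¹ with hG
  obtain ⟨h, hh⟩ := exists_algBorderRank_eq_approxRank T
  have hTM : approxRank h T ≤ M := by rw [← hh, hM]; exact hle
  obtain ⟨u, v, w, hd⟩ := exists_isApproxDecomposition_of_approxRank_le hTM
  set L : (((Fin (N + 1) → Fin 3) ⊕ ι') → K) → Fin M → Fin M → K :=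
    fun ξ b c => ∑ x, ∑ b', ∑ c', ξ x * G (e b) b' * (if c' = e c then (1 : K) else 0) * T x b' c'
    with hL
  have hdL := hd.restrict (fun (ξ : ((Fin (N + 1) → Fin 3) ⊕ ι') → K) x => ξ x)
    (fun (b : Fin M) b' => G (e b) b') (fun (c : Fin M) c' => if c' = e c then (1 : K) else 0)
  have HL : ∀ ξ, Matrix.of (L ξ) = (G * contractFirst ξ T).submatrix e e := by
    intro ξ
    ext b c
    simp only [hL, Matrix.of_apply, Matrix.submatrix_apply, Matrix.mul_apply, contractFirst_apply,
      mul_ite, mul_one, mul_zero, ite_mul, zero_mul, Finset.sum_ite_eq', Finset.mem_univ, if_true]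
    rw [Finset.sum_comm]
    refine Finset.sum_congr rfl fun b' _ => ?_
    rw [Finset.mul_sum]
    refine Finset.sum_congr rfl fun x _ => ?_
    ring
  set ξ₀ : ((Fin (N + 1) → Fin 3) ⊕ ι') → K :=
    Sum.elim (prodCovector fun _ : Fin (N + 1) => cwα K) σ with hξ₀
  set ξ₁ : ((Fin (N + 1) → Fin 3) ⊕ ι') → K :=
    Sum.elim (prodCovector (Fin.cons (cwβ K) fun _ : Fin N => cwα K)) (fun _ => 0) with hξ₁
  set ξ₂ : ((Fin (N + 1) → Fin 3) ⊕ ι') → K :=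
    Sum.elim (prodCovector (Fin.cons (cwγ K) fun _ : Fin N => cwα K)) (fun _ => 0) with hξ₂
  have hS := slice_mul_adjugate_mul_comm_of_isApproxDecomposition hdL ξ₁ ξ₀ ξ₂
  have hinv : (contractFirst σ s)⁻¹ * contractFirst σ s = 1 :=
    Matrix.nonsing_inv_mul _ ((Matrix.isUnit_iff_isUnit_det _).1 hσ)
  have hG0 : G * contractFirst ξ₀ T = 1 := by
    rw [hξ₀, hT, contractFirst_sumElim_directSumTensor,
      contractFirst_prodCovector_kroneckerPow, hG, Matrix.fromBlocks_multiply]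
    simp only [Matrix.mul_zero, Matrix.zero_mul, add_zero, zero_add, hinv,
      powMatrix_eq_piMatrix, piMatrix_mul, cwSinv_mul_S, piMatrix_one, Matrix.fromBlocks_one]
  have hone : Matrix.of (L ξ₀) = 1 := by
    rw [HL, hG0, Matrix.submatrix_one_equiv]
  rw [hone, adjugate_one, Matrix.mul_one, Matrix.mul_one, HL, HL, Matrix.submatrix_mul_equiv,
    Matrix.submatrix_mul_equiv] at hS
  have hS' : G * contractFirst ξ₁ T * (G * contractFirst ξ₂ T) =
      G * contractFirst ξ₂ T * (G * contractFirst ξ₁ T) := by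
    have := congrArg (fun A : Matrix (Fin M) (Fin M) K => A.submatrix e.symm e.symm) hS
    simpa only [Matrix.submatrix_submatrix, Equiv.self_comp_symm, Matrix.submatrix_id_id] using this
  have hG1 : G * contractFirst ξ₁ T = Matrix.fromBlocks
      (piMatrix fun i => cwSinv K *
        contractFirst ((Fin.cons (cwβ K) (fun _ : Fin N => cwα K) : Fin (N + 1) → Fin 3 → K) i)
          (cwTensor K 2))
      0 0 0 := by
    rw [hξ₁, hT, contractFirst_sumElim_directSumTensor, contractFirst_zero,
      contractFirst_prodCovector_kroneckerPow, hG, Matrix.fromBlocks_multiply]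
    simp only [Matrix.mul_zero, Matrix.zero_mul, add_zero, powMatrix_eq_piMatrix, piMatrix_mul]
  have hG2 : G * contractFirst ξ₂ T = Matrix.fromBlocks
      (piMatrix fun i => cwSinv K *
        contractFirst ((Fin.cons (cwγ K) (fun _ : Fin N => cwα K) : Fin (N + 1) → Fin 3 → K) i)
          (cwTensor K 2))
      0 0 0 := by
    rw [hξ₂, hT, contractFirst_sumElim_directSumTensor, contractFirst_zero,
      contractFirst_prodCovector_kroneckerPow, hG, Matrix.fromBlocks_multiply]
    simp only [Matrix.mul_zero, Matrix.zero_mul, add_zero, powMatrix_eq_piMatrix, piMatrix_mul]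
  rw [hG1, hG2, Matrix.fromBlocks_multiply, Matrix.fromBlocks_multiply] at hS'
  simp only [Matrix.mul_zero, Matrix.zero_mul, add_zero, piMatrix_mul] at hS'
  have hP := (Matrix.fromBlocks_inj.1 hS').1
  have hentry := congr_fun (congr_fun hP (Fin.cons 1 fun _ => 0)) (Fin.cons 2 fun _ => 0)
  simp only [piMatrix_apply, Fin.prod_univ_succ, Fin.cons_zero, Fin.cons_succ, cwSinv_mul_S,
    Matrix.one_apply_eq, Finset.prod_const_one, mul_one] at hentry
  rw [cw_XY_entry, cw_YX_entry] at hentry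
  exact zero_ne_one hentry

/-- `S = T_cw,2(a₀^* + a₁^*)` is invertible. [folklore] -/
theorem isUnit_contractFirst_cwα : IsUnit (contractFirst (cwα K) (cwTensor K 2)) :=
  (Matrix.isUnit_iff_isUnit_det _).2 (Matrix.isUnit_det_of_left_inverse (cwSinv_mul_S K))

/-- **Copies as catalyst**: `2·3^N < R̲(T_cw,2^{⊠N} ⊕ T_cw,2^{⊠N})` for all `N ≥ 1` (the power
is its own `1_A`-generic catalyst: its slice at `(a₀^*+a₁^*)^{⊗N}` is `S^{⊗N}`).  Level `N = 1` is
`8 = R̲(T_cw,2 ⊕ T_cw,2)` (`SoloInformedCatalystDoor.lean`); on paper `R̲ ≥ 8·3^{N-1}`.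
[cite: Landsberg2017, Thm. 2.2.2.1] -/
theorem lt_algBorderRank_kroneckerPow_cwTensor_two_directSum_self (N : ℕ) :
    3 ^ (N + 1) + 3 ^ (N + 1) <
      algBorderRank (directSumTensor (kroneckerPow (cwTensor K 2) (N + 1))
        (kroneckerPow (cwTensor K 2) (N + 1))) := by
  have hσ : IsUnit (contractFirst (prodCovector fun _ : Fin (N + 1) => cwα K)
      (kroneckerPow (cwTensor K 2) (N + 1))) := by
    rw [contractFirst_prodCovector_kroneckerPow, ← powMatrix_eq_piMatrix]
    exact isUnit_powMatrix (isUnit_contractFirst_cwα K) (N + 1)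
  have h := lt_algBorderRank_kroneckerPow_cwTensor_two_directSum_of_isUnit_slice K
    (kroneckerPow (cwTensor K 2) (N + 1)) _ hσ N
  simpa [Fintype.card_fun] using h

/-- The slice of `⟨n,n,n⟩` at the trace covector `Z ↦ tr Z` is the transposition permutation matrix
`X_{κμ} ↔ Y_{μκ}`. [folklore] -/
theorem contractFirst_trace_matMulTensor (n : ℕ) (b c : Fin n × Fin n) :
    contractFirst (fun a : Fin n × Fin n => if a.1 = a.2 then (1 : K) else 0) (matMulTensor K n n n)
      b c = if c = (b.2, b.1) then 1 else 0 := by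
  rw [contractFirst_apply, Finset.sum_eq_single (b.1, c.2)]
  · dsimp only [matMulTensor]
    by_cases hc : c = (b.2, b.1)
    · subst hc
      simp
    · rw [if_neg hc]
      by_cases h1 : b.1 = c.2
      · have h2 : ¬ (b.1 = b.1 ∧ b.2 = c.1 ∧ c.2 = c.2) := fun h =>
          hc (Prod.ext_iff.2 ⟨h.2.1.symm, h1.symm⟩)
        rw [if_pos h1, one_mul, if_neg h2]
      · rw [if_neg h1, zero_mul]
  · intro a _ ha
    by_cases h : a.1 = b.1 ∧ b.2 = c.1 ∧ a.2 = c.2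
    · exact (ha (Prod.ext_iff.2 ⟨h.1, h.2.2⟩)).elim
    · simp only [matMulTensor]
      rw [if_neg h, mul_zero]
  · simp

/-- That permutation matrix is an involution, hence invertible. [folklore] -/
theorem isUnit_contractFirst_trace_matMulTensor (n : ℕ) :
    IsUnit (contractFirst (fun a : Fin n × Fin n => if a.1 = a.2 then (1 : K) else 0)
      (matMulTensor K n n n)) := by
  set P := contractFirst (fun a : Fin n × Fin n => if a.1 = a.2 then (1 : K) else 0)
    (matMulTensor K n n n) with hPdef
  have hP : ∀ b c, P b c = if c = (b.2, b.1) then 1 else 0 := contractFirst_trace_matMulTensor K n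
  have hPP : P * P = 1 := by
    ext b c
    rw [Matrix.mul_apply, Finset.sum_eq_single (b.2, b.1)]
    · rw [hP, hP, if_pos rfl, one_mul, Matrix.one_apply]
      by_cases h : b = c
      · subst h; simp
      · rw [if_neg h, if_neg]
        rintro rfl
        exact h rfl
    · intro x _ hx
      rw [hP b x, if_neg hx, zero_mul]
    · simp
  exact (Matrix.isUnit_iff_isUnit_det _).2 (Matrix.isUnit_det_of_left_inverse hPP)

/-- **Matrix multiplication catalysts** (Coppersmith–Winograd 1982 style): for all `N ≥ 1`, `n`,
`3^N + n² < R̲(T_cw,2^{⊠N} ⊕ ⟨n,n,n⟩)`.  Since `Q̃(⟨n,n,n⟩) = n²`, the catalyst inequality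
`R̃(T_cw,2)^N + Q̃(s) ≤ R̲(T_cw,2^{⊠N} ⊕ s)` never certifies `R̃(T_cw,2) = 3` with `s = ⟨n,n,n⟩`.
[cite: Landsberg2017, Thm. 2.2.2.1] -/
theorem lt_algBorderRank_kroneckerPow_cwTensor_two_directSum_matMul (N n : ℕ) :
    3 ^ (N + 1) + n * n <
      algBorderRank
        (directSumTensor (kroneckerPow (cwTensor K 2) (N + 1)) (matMulTensor K n n n)) := by
  have h := lt_algBorderRank_kroneckerPow_cwTensor_two_directSum_of_isUnit_slice K
    (matMulTensor K n n n) _ (isUnit_contractFirst_trace_matMulTensor K n) N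
  simpa [Fintype.card_prod] using h

end Generic

end Summit.MatrixMultiplication.MatrixMultiplication.Theorems

end
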